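import Literature.NumberTheory.GaloisCohomology.KatoCohomologyDifferentialForms
import Summits.ResolutionOfSingularities.ResolutionOfSingularities.Theorems.WildPurityPurityTransferStubBkForward
import HarnessLib

/-!
# Stub `stub_bkDescends` of crux stmt-ResolutionOfSingularities-17142
# (`WildPurity.PurityTransfer`, line `birth`, lead c1 skeleton rev L4)

The DESCENT step of the Bloch–Kato presentation (Bloch–Kato 1986, Lemma (4.2), for a field `K` of
characteristic `p`): any ADDITIVE map `ψ₀ : Ωⁿ_K = ⋀ⁿ_K Ω[K⁄ℤ] → KatoCohomologySymbolic p K n` with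
`ψ₀ (a • dlogForm K b) = [a, b}` vanishes on `exactForms K n ⊔ artinSchreierForms K p n`, i.e. it
factors through Kato's group of forms `KatoCohomologyDeRham p K n = Ωⁿ_K ⧸ (dΩⁿ⁻¹_K ⊔ AS)`:

* on the Artin–Schreier forms `(a ^ p - a) • dlogForm K b` by relation (5)
  (`KatoCohomologySymbolic.symbol_artinSchreier`);
* on the exact forms `dη`, `η ∈ Ωⁿ⁻¹_K`: `Ωⁿ⁻¹_K` is `K`-spanned by the `dlogForm K y` (hypothesis
  `hspan`), so (`Submodule.span_induction`, the predicate `∀ c, ψ₀ (d (c • η)) = 0` being stable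
  under sums and `K`-scalings) it suffices to treat `η = c • dlogForm K y`; for `c = 0` this is
  `d 0 = 0`, and for a unit `c = u` the landed computation
  `d (u • dlogForm K y) = du ∧ dlogForm K y = u • dlogForm K (Fin.cons u y)`
  (`bkForward_d_smul_dlogForm`, from `d (dlog) = 0`, file `WildPurityPurityTransferStubBkForward`)
  has `ψ₀`-image `[u, u, y₀, …} = 0`, relation (4) (`KatoCohomologySymbolic.symbol_apply_self`).
-/

set_option linter.dupNamespace false

noncomputable section

universe u

open Literature.NumberTheory.GaloisCohomology
open Literature.AlgebraicGeometry.Crystalline.KaehlerExteriorDerivative (kaehlerExteriorDerivative)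

namespace Summit.ResolutionOfSingularities.ResolutionOfSingularities.Theorems.WildPurityPurityTransfer

/-- **Stub `stub_bkDescends`** (Bloch–Kato 1986, Lemma (4.2), descent to Kato's group of forms):
for a field `K` of characteristic `p` whose `Ωᵐ_K` are spanned by the logarithmic forms (`hspan`),
any additive `ψ₀ : Ωⁿ_K → KatoCohomologySymbolic p K n` with `ψ₀ (a • dlogForm K b) = [a, b}` kills
the exact forms `dΩⁿ⁻¹_K` (relation (4), via `d (u • dlogForm K y) = u • dlogForm K (Fin.cons u y)`)
and the Artin–Schreier forms `(a ^ p - a) • dlogForm K b` (relation (5)).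
[cite: BlochKato1986, Lemma (4.2)] -/
theorem stub_bkDescends (p : ℕ) [Fact p.Prime] (K : Type u) [Field K] [CharP K p] (n : ℕ)
    (hspan : ∀ m : ℕ, Submodule.span K (Set.range (dlogForm K (n := m))) = ⊤)
    (ψ₀ : (⋀[K]^n (Ω[K⁄ℤ])) →+ KatoCohomologySymbolic p K n)
    (hψ₀ : ∀ (a : K) (b : Fin n → Kˣ), ψ₀ (a • dlogForm K b) = KatoCohomologySymbolic.symbol p a b)
    (ω : ⋀[K]^n (Ω[K⁄ℤ])) (hω : ω ∈ exactForms K n ⊔ artinSchreierForms K p n) : ψ₀ ω = 0 := by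
  -- (ii) the Artin–Schreier forms die by relation (5)
  have hAS : artinSchreierForms K p n ≤ ψ₀.ker := by
    unfold artinSchreierForms
    rw [AddSubgroup.closure_le]
    rintro _ ⟨a, b, rfl⟩
    rw [SetLike.mem_coe, AddMonoidHom.mem_ker, hψ₀, KatoCohomologySymbolic.symbol_artinSchreier]
  -- (i) the exact forms die by relation (4)
  have hex : exactForms K n ≤ ψ₀.ker := by
    cases n with
    | zero =>
      rw [exactForms_zero]
      exact bot_le
    | succ m =>
      intro x hx
      obtain ⟨η, rfl⟩ := (mem_exactForms_succ_iff K m x).1 hx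
      clear hx
      rw [AddMonoidHom.mem_ker]
      have hη : η ∈ Submodule.span K (Set.range (dlogForm K (n := m))) := by
        rw [hspan m]
        exact Submodule.mem_top
      suffices h : ∀ c : K, ψ₀ (kaehlerExteriorDerivative ℤ K m (c • η)) = 0 by
        simpa only [one_smul] using h 1
      induction hη using Submodule.span_induction with
      | mem x hx =>
        obtain ⟨y, rfl⟩ := hx
        intro c
        rcases eq_or_ne c 0 with rfl | hc
        · rw [zero_smul, map_zero, map_zero]
        · obtain ⟨u, rfl⟩ := hc.isUnit
          rw [bkForward_d_smul_dlogForm, hψ₀]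
          have h :=
            KatoCohomologySymbolic.symbol_apply_self p (Fin.cons u y : Fin (m + 1) → Kˣ) 0
          rwa [Fin.cons_zero] at h
      | zero =>
        intro c
        rw [smul_zero, map_zero, map_zero]
      | add x x' _ _ hx hx' =>
        intro c
        rw [smul_add, map_add, map_add, hx c, hx' c, add_zero]
      | smul a x _ hx =>
        intro c
        rw [smul_smul]
        exact hx (c * a)
  exact (AddMonoidHom.mem_ker (f := ψ₀)).1 (sup_le hex hAS hω)

end Summit.ResolutionOfSingularities.ResolutionOfSingularities.Theorems.WildPurityPurityTransfer

end
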